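import Summits.QuantumFields.YangMills.Theorems.FemtoCurvatureSkewness.Negative.ZeroCoupling
import Summits.QuantumFields.YangMills.Theorems.FemtoCurvatureSkewness.Negative.WeakCoupling
import Summits.QuantumFields.YangMills.Theorems.FemtoCurvatureSkewness.Negative.WildPackage

/-!
# Disproof of `FemtoCurvatureSkewness` (crux `stmt-QuantumFields-9365`, route `LangevinControlUV`) — findings

Standing-adversary work file (cdisprove).  Prose lives in docstrings; `sorry` only in §4 (near-misses).
Everything in §§1–3 is kernel-checked and uses tree objects only.

## What the crux says (read back from the elaborated term, `crux_iff` below is `Iff.rfl`)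
`∀ G` compact simple Lie (`IsCompactSimpleLieGroup`: connected, non-abelian, faithful unitary rep — no finite or
abelian junk), `∀ r : LatticeRep G`, `∀ a : ℝ → ℝ`:  TwoPointPackage r a → SkewnessPackage r a, where
* `TwoPointPackage` = the UV-a two-point package of `FemtoCurvatureTwoPoint` (positivity of `a`, `a → 0`, ONE shape
  `Γ ∈ (0,1]` on `(0,ℓ₀]`, two-sided axis bounds `cΓ(n a) ≤ n⁸ Cov ≤ CΓ(n a)` for `1 ≤ n ≤ L/8`, all-pairs upper bound,
  on every torus with `β ≥ β₀`, `L·a(β) ≤ ℓ₀`);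
* `SkewnessPackage` = `∃ Γ₃ > 0 on (0,ℓ₁], β₁, ℓ₁, c₃ > 0`, on every torus with `β ≥ β₁`, `L·a(β) ≤ ℓ₁`:
  `c₃ Γ₃(n a(β)) ≤ n¹² |κ₃(P_0^{01}, P_{ne₂}^{01}, P_{ne₃}^{01})|` for `1 ≤ n ≤ L/8`
  (`κ₃` = the correct third cumulant `E[XYZ] − Σ E[X]Cov(Y,Z) − E X E Y E Z`, `P = N − Re tr r(U_p)`).

## Findings
1. **No junk, no vacuity handle.**  `TwoPointPackage r a` is never vacuous: for every `L` the admissible couplings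
   `{β ≥ β₀, L a(β) ≤ ℓ₀}` contain a neighbourhood of `+∞` (`a → 0`), so it asserts `Cov_{L,β}(P_0,P_{ne₂}) > 0` with
   two-sided control — a genuine weak-coupling fact about `G`-lattice gauge theory that the tree cannot decide.  Hence
   **every unconditional refutation must first produce a witness `(G, r, a)` of the two-point package**, i.e. an
   instance of crux `FemtoCurvatureTwoPoint` (9363) (`refutation_needs_twoPoint_witness`, §3).  This is why the crux
   resists cheap disproof: it is shielded by 9363.
2. **The conclusion depends on `a` only through level sets** (`skewnessPackage_iff_levelwise`): since `Γ₃` is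
   existential with no upper bound and no monotonicity, `SkewnessPackage r a` ⇔ on every level set
   `{(L,β,n) admissible : n·a(β) = s}` the quantity `n¹²|κ₃|` has a positive infimum.  Consequences:
   (a) whatever `a` is, the crux forces **fixed-torus eventual non-vanishing**: `∀ L ≥ 8, ∀ n ≤ L/8, ∀ᶠ β → ∞,
   κ₃(L,β,n) ≠ 0` (`eventually_kappa3_ne_zero`, `crux_forces_eventual_nonvanishing`) — the toron/semiclassical
   regime at FIXED `L`, not a continuum statement; (b) a single admissible zero of `β ↦ κ₃(L,β,n)` inside every
   window `(β₁,ℓ₁)` kills it (`not_crux_of_admissible_zero`, `not_crux_of_frequently_zero`); (c) `β ↦ κ₃(L,β,n)` is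
   CONTINUOUS (`continuous_kappa3`, §2c: `E_β = Z⁻¹∫e^{−βS}·`, parametric integral over the compact configuration
   space), vanishes at `β = 0` (4) and at `β = ∞` (4b): every sign change in an admissible window is an exact zero
   (`exists_zero_of_sign_change`) — the crux bets that beyond `β₁` the cumulant never returns to zero in any box the
   unit map opens.
3. **Adversarial unit maps (why `∀ a` is dangerous; heuristic, not formalised).**  The sibling crux's triage
   (`Cruxes/FemtoCurvatureTwoPoint/TRIAGE-r1-1.md`, idea `generic-step-gamma-encoding`) shows that a slowly
   decaying GENERIC STEP map `a` passes `TwoPointPackage` on fixed-torus `β → ∞` asymptotics alone.  Sharper: a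
   NARROW prime-step map (`a = 1/q_k` on cells of width `1/q_k`, `q_k` the k-th prime, `ℓ₀ < 1`) makes every
   `Γ`-level cell a single (cell, n, finitely many L) block, so the two-sided clause reduces to bounded oscillation
   of `n⁸Cov` inside tiny β-cells — no multiscale content at all — while the femto guard `L a(β) ≤ ℓ` admits tori
   `L ≤ ℓ q_{k(β)} ≈ ℓ·exp(exp β)`, i.e. the CONFINED regime.  For such a witness the conclusion demands
   `κ₃(L,β,n) ≠ 0` for ALL `β ≥ β₁`, all `L ≤ ℓ₁ q_{k(β)}`, all `n ≤ L/8`: any sign change of the real-analytic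
   `β ↦ κ₃(L,β,n)` above `β₁` is an exact zero and kills it.  UV sign: `+` (tree-level triangle
   `8 G(0,ne₂)G(ne₂,ne₃)G(ne₃,0) > 0`, `G(ne₂) = 1/(π²n⁴)`).  IR sign (n ≫ ξ): governed by glueball data; the
   Feynman–Hellmann identity `Σ_x ⟨G|P_x|G⟩_conn = ∂(a m_G)/∂β / 6 < 0` makes the "through-vertex" channel
   (`∼ e^{-2 m n}`) NEGATIVE; the Steiner/Y channel (`∼ e^{-1.93 m n}`, cubic glueball coupling) has unknown sign.
   If the IR sign is `−` at arbitrarily large β (a continuum property of `⟨F₀₁²F₀₁²F₀₁²⟩`), the crux is FALSE for the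
   narrow-step witness.  (Cycle 2, §5 / p94300: such adversarial package companions exist as soon as ONE package map
   exists — `exists_incomparable_package_of_package`, no uniformities; for them the conclusion is pointwise
   non-vanishing of `κ₃` on the honest map's femto configurations.)
   STRONG-COUPLING SIGN (paper, SU(2) fundamental, `T = χ_{1/2}`, weight `e^{β Σ_p T_p}`): the k-th β-derivative of
   `κ₃^β(T_A,T_B,T_C)` at 0 is `Σ_{p_1…p_k} κ^{Haar}(T_A,T_B,T_C,T_{p_1},…,T_{p_k})`; a family contributes only if
   no plaquette has a free bond (private-bond lemma) and it is cumulant-connected.  `k ≤ 7`: impossible (B's and C's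
   bonds need 4 + 4 plaquettes); `k = 8` (`{A,B,C} ∪ S_AB ∪ S_AC`, the two unit tubes): A's bonds are covered THREE
   times, `½⊗½⊗½ ∌ 0`, zero for SU(2) (NOT for SU(3): baryonic `ρ⊗ρ⊗ρ ∋ 1`, sign open); `k = 9`: the unique family
   `{A', S_AB, S_AC}` (A doubled) has `κ₁₂ = M − Var(χ_A)·M₁₀ − 2κ₆(cube)² = 2d⁻⁸ − d⁻⁸ − 2d⁻⁸ = −d⁻⁸` (disk formula
   `∫∏_{open box} χ = d^{V−E}χ(U_A) = d⁻⁴χ(U_A)`, `E[χ⁴] = 2`): `κ₃(T,T,T) = −β⁹/256 + O(β¹⁰)`, hence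
   `κ₃(P,P,P) = +β⁹/256 + … > 0`; for separation n the tubes give `+d^{−8n} β^{8n+1} > 0`.  So for SU(2)
   FUNDAMENTAL the strong-coupling sign AGREES with tree level (`+`): no zero of `β ↦ κ₃(L,β,n)` is forced between
   the two regimes — the polymer-repulsion term `−2κ₆²`, not a "connected surface", dominates.
   THE SIGN IS (G, r)-DEPENDENT.  For irreducible r (T = Re tr r, open-box conditional mean `E[X̃|U_A] = c·T_A`,
   `c = d_r⁻⁴/16 > 0`, or `d⁻⁴` for real characters) the `k = 8` family `{A,B,C} ∪ S_AB ∪ S_AC` has Ursell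
   coefficient `κ(F₈) = M(F₈) = c²·E_Haar[T_r³]`, and `E[T_r³] = (2m₃ + 6m₂₁)/8 ≥ 0` with `m₃ = [r⊗r⊗r : 1]`,
   `m₂₁ = [r⊗r : r]`: positive exactly when `r ⊗ r ∋ r` or `r̄` — SU(N≥3) fundamental (baryon junction,
   `E[T³] = 1/4`), every adjoint representation — and ZERO for SU(2) fundamental (`½⊗½ ∌ ½`).  For reducible r
   the same family gives `M(F₈) = Σ_{j,k} w_j w_k E[T_r χ_j χ_k] ≥ 0` (`w_j = d_j⁻⁴·const > 0`, sum over
   constituents), positive iff some constituent of `r` or `r̄` occurs in `r ⊗ r`; e.g. SU(2), `r = ½ ⊕ 1`: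
   `M(F₈) = 1/256 + 2/1296 + 1/6561 ≈ 5.6·10⁻³`.  Whenever `M(F₈) > 0`:
   `κ₃(T,T,T) = +M(F₈) β⁸ + O(β⁹)`, i.e. **`κ₃(P,P,P) < 0` at strong coupling, OPPOSITE to tree level**, so by
   `continuous_kappa3` EVERY torus `L ≥ 8n` carries an exact zero `β*(L, n; G, r) ∈ (0, ∞)` of the crux's cumulant
   (given tree-level positivity at weak coupling, TreeTriangle-r1-i1.md).  (SU(3) check: the `k = 9` coefficient
   `c²(E[T⁴] − E[T²]² … ) = c²(3/4 − 1/4 − 1/2) = 0`, so the negative `β⁸` term leads cleanly.)  For (L=8, n=1) these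
   zeros sit at intermediate coupling and are dodged by the existential `β₁`; the crux dies for an admissible
   adversarial `a` iff such zeros persist at ARBITRARILY LARGE β for some (L, n) — i.e. iff the confined-regime sign
   at weak bare coupling is the strong-coupling one (`−` for SU(3)): the open IR-sign question of finding 3, now with
   a definite strong-coupling anchor.  NUMERICS (MCSignScan-c1.md): j008044/j008055 (SU(2) fundamental, L = 6, 8):
   `κ₃(L,β,1) > 0` at 7–34σ for all `β_tree ∈ [0.9, 3.0]`, unresolved (`|κ₃| ≲ 1.5·10⁻⁴`) below, NO sign change
   resolved, ratio `κ₃/Cov^{3/2} ≈ 0.40–0.51` β-stable — as predicted (`+` at both ends); j010028 (SU(2), `r = ½ ⊕ 1`,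
   Metropolis, L = 6, capped at 0.5 h): `+` at 14–31σ on the weak side of the bulk crossover (`β_tree = 0.6–0.9`), the
   predicted `−0.0056 β⁸ ≈ −10⁻⁵` strong side is far below MC resolution — the zero `β*(6,1)` of that (G, r) is not
   exhibited numerically and rests on the analytic leading order (finite torus ⇒ `κ₃` real-analytic in `β`).
4. **β = 0 is an exact zero** (`kappa3_zero_coupling`): under product Haar the three plaquettes are independent
   (private bond of the `ne₃`-plaquette), so `κ₃ = 0` on every torus, `n ≢ 0 (mod L)`.  Hence the NATURAL
   STRENGTHENING "skewness bound at all couplings / all volumes" is false (`not_skewnessBoundAllCouplings`): the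
   threshold `β₁` is load-bearing (barrier `FixedCouplingUltralocality` in its extreme form).  Same mechanism in the
   route's calibration model YM₂: plaquettes are independent at EVERY β (heat-kernel/character factorisation), so the
   tree-level "triangle" is a genuinely 4-d propagating effect — the dictionary's cheapest falsifier cannot see UV-c.
4b. **Tightness of `0 < Γ₃` (weak-coupling concentration, §2b).**  On every FIXED torus `κ₃(L,β,n) → 0` as
   `β → ∞` (`tendsto_kappa3`: Laplace principle `μ_{β,L}{S ≥ ε} ≤ e^{−βε/2}/p(ε)` ⇒ `E_β[P] → 0` ⇒ every mixed
   moment `→ 0`).  Hence for EVERY skewness package `Γ₃(n·a(β)) → 0` along the grid (`skewnessShape_tendsto_zero`,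
   box `L = 8n`), no package has `inf Γ₃ > 0` (`not_skewnessPackageWith_of_shape_ge`), and the NATURAL
   STRENGTHENING II "scale-invariant skewness `c₃ ≤ n¹²|κ₃|`" is false for every `G, r, a`
   (`not_uniformSkewness`).  For provers: your `Γ₃` must decay at `0⁺` at least like `|κ₃|` of the `(8n)⁴` torus
   (tree level `n¹²κ₃ ≍ g₀⁶ ≍ β⁻³`); together with (2a) the crux pins, on each fixed torus, a function that is
   eventually non-zero AND tends to zero — only its SIGN pattern across `(L, n, β)` is at stake.
5. **Load-bearing hypotheses.**  `_false_without_TwoPoint` (drop the package) is NOT provable here for the same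
   reason as (1) (one still needs `κ₃`-knowledge at β > 0).  Within the conclusion: `β₁` load-bearing by (4); the femto
   guard `L a ≤ ℓ₁` is load-bearing only jointly with the class of admissible `a` (3).  `IsCompactSimpleLieGroup`:
   for the TRIVIAL group every `P ≡ 0`, the two-point package fails (needs `Cov > 0`), so triviality is excluded by
   the hypothesis, not by simplicity; finite/abelian `G` are excluded by `ConnectedSpace`/non-abelian.
6. **Repairs the planner may want (not mine to make):** pin the unit map (`Continuous a` + antitone, or
   `MonotoneOn Γ`), or ask for the skewness witness only along ONE admissible family `(L_k, β_k, n_k)` with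
   `n_k a(β_k) → s₀ > 0` (what `IsNonGaussian` downstream actually consumes), instead of all admissible triples.
7. **Line `Sketch-ideator3` (cycle 2, §5).**  Its residual stub `PackagePinsScale` ("package maps are comparable") is
   EQUIVALENT to the unsatisfiability of the crux's hypothesis (`packagePinsScale_iff_package_unsatisfiable`, LANDED
   p94300): it closes the typed crux only vacuously (the engine stub is idle), and it is false given one instance of
   `FemtoCurvatureTwoPoint` (`packagePinsScale_false_of_twoPoint`).  No engine-free repair; the `∀ a` shell is planner
   business (R1).  The engine's typed output `CouplingBounds` is numerically plausible at (8, n=1) for `β_tree ≥ 1.35`.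

## Index
LANDED (imported): §1 vocabulary + `femtoCurvatureSkewness_iff` · §2 β = 0 (`kappa3_zero_coupling`,
`not_skewnessBoundAllCouplings`) · §3-part (`skewnessPackage_iff_levelwise`, `eventually_kappa3_ne_zero`, `zero_of_sign_change`)
— `Negative/ZeroCoupling.lean` (p74674); §2b concentration (`tendsto_kappa3`, `skewnessShape_tendsto_zero`,
`not_skewnessPackageWith_of_shape_ge`, `not_uniformSkewness`) · §2c continuity (`wE_eq_inv_mul_integral`, `continuous_wE`,
`continuous_kappa3`, `exists_zero_of_sign_change`, `twoPointPackage_forces_cov_pos`) — `Negative/WeakCoupling.lean`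
(p75362); §5 residual-stub kill (`exists_wildMap_two_sided`, `twoPointPackage_transfer`,
`exists_incomparable_package_of_package`, `packagePinsScale_iff_package_unsatisfiable`,
`packagePinsScale_false_of_twoPoint`) — `Negative/PackagePinsScale.lean` (p94300).
IN THIS FILE: §3 crux-level (`crux_forces_eventual_nonvanishing`, `not_crux_of_admissible_zero`,
`not_crux_of_frequently_zero`, `refutation_needs_twoPoint_witness`) · §5 line (`femtoCurvatureSkewness_of_packagePinsScale`,
`line_residual_false_of_twoPoint`) · §4 near-misses / targets.
-/

noncomputable section

namespace Summit.QuantumFields.YangMills.Cruxes.FemtoCurvatureSkewness.Disproof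

open MeasureTheory Filter Topology
open Literature.MathematicalPhysics.QuantumFieldTheory
open Summit.QuantumFields.YangMills.Theses.LangevinControlUV (FemtoCurvatureSkewness FemtoCurvatureTwoPoint)
open Summit.QuantumFields.YangMills.Theorems.FemtoCurvatureSkewness.Negative

/-! ## §5-inline (TEMPORARY): verbatim copy of the LANDED `Theorems/FemtoCurvatureSkewness/Negative/PackagePinsScale.lean`
(p94300, commit afc18b329f82), inlined in this namespace only until the Lean farm serves the new module to work files;
the import-based version of this work file is kept in the disprover's folder (`Disproof_import.lean`). -/

/-! ## A two-sided wild unit map -/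

/-- `k · log 2 ∈ Λ` for `k : ℤ`. -/
theorem int_mul_log_two_mem_logSpan (k : ℤ) :
    (k : ℝ) * Real.log 2 ∈ (Submodule.span ℚ (Set.range fun n : ℕ => Real.log (n : ℝ))) := by
  have h2 : Real.log ((2 : ℕ) : ℝ) ∈ (Submodule.span ℚ (Set.range fun n : ℕ => Real.log (n : ℝ))) :=
    log_nat_mem_logSpan 2
  have : ((k : ℚ) : ℝ) • Real.log ((2 : ℕ) : ℝ) ∈ (Submodule.span ℚ (Set.range fun n : ℕ => Real.log (n : ℝ))) :=
    Submodule.smul_mem (Submodule.span ℚ (Set.range fun n : ℕ => Real.log (n : ℝ))) (k : ℚ) h2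
  simpa [Rat.cast_intCast, Nat.cast_ofNat] using this

/-- **Two-sided wild exponent**: `h ≤ φ ≤ h + log 2` with pairwise differences outside `Λ` (INTEGER shifts by
`log 2` of the lead's translation-free map). -/
theorem exists_wildExponent_two_sided (h : ℝ → ℝ) :
    ∃ φ : ℝ → ℝ, (∀ x, h x ≤ φ x ∧ φ x ≤ h x + Real.log 2) ∧
      ∀ x y : ℝ, φ x - φ y ∈ (Submodule.span ℚ (Set.range fun n : ℕ => Real.log (n : ℝ))) → x = y := by
  obtain ⟨t, ht⟩ := exists_translation_free_map
  refine ⟨fun x => t x + (⌈(h x - t x) / Real.log 2⌉ : ℝ) * Real.log 2, fun x => ?_, fun x y hxy => ?_⟩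
  · have hlog : 0 < Real.log 2 := Real.log_pos (by norm_num)
    have hceil : (h x - t x) / Real.log 2 ≤ (⌈(h x - t x) / Real.log 2⌉ : ℝ) := Int.le_ceil _
    have hceil' : (⌈(h x - t x) / Real.log 2⌉ : ℝ) < (h x - t x) / Real.log 2 + 1 := Int.ceil_lt_add_one _
    have h1 := mul_le_mul_of_nonneg_right hceil hlog.le
    have h2 := mul_le_mul_of_nonneg_right hceil'.le hlog.le
    rw [div_mul_cancel₀ _ hlog.ne'] at h1
    rw [add_mul, div_mul_cancel₀ _ hlog.ne', one_mul] at h2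
    constructor <;> linarith
  · apply ht x y
    have hk : ((⌈(h x - t x) / Real.log 2⌉ : ℝ) * Real.log 2 -
        (⌈(h y - t y) / Real.log 2⌉ : ℝ) * Real.log 2) ∈
          (Submodule.span ℚ (Set.range fun n : ℕ => Real.log (n : ℝ))) :=
      Submodule.sub_mem (Submodule.span ℚ (Set.range fun n : ℕ => Real.log (n : ℝ)))
        (int_mul_log_two_mem_logSpan _) (int_mul_log_two_mem_logSpan _)
    have heq : t x - t y = (t x + (⌈(h x - t x) / Real.log 2⌉ : ℝ) * Real.log 2 -
        (t y + (⌈(h y - t y) / Real.log 2⌉ : ℝ) * Real.log 2)) -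
        ((⌈(h x - t x) / Real.log 2⌉ : ℝ) * Real.log 2 - (⌈(h y - t y) / Real.log 2⌉ : ℝ) * Real.log 2) := by
      ring
    rw [heq]
    exact Submodule.sub_mem (Submodule.span ℚ (Set.range fun n : ℕ => Real.log (n : ℝ))) hxy hk

/-- **The two-sided wild unit map**: for every positive `g` there is `a` with `g/2 ≤ a ≤ g` whose level sets are
singletons (`n·a β = n'·a β'` forces `β = β'`, `n = n'`; `√m·a β = n''·a β''` forces `β = β''`, `√m = n''`). -/
theorem exists_wildMap_two_sided (g : ℝ → ℝ) (hg : ∀ β, 0 < g β) :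
    ∃ a : ℝ → ℝ, (∀ β, 0 < a β) ∧ (∀ β, a β ≤ g β) ∧ (∀ β, g β ≤ 2 * a β) ∧
      (∀ (β β' : ℝ) (n n' : ℕ), 1 ≤ n → 1 ≤ n' → (n : ℝ) * a β = n' * a β' → β = β' ∧ n = n') ∧
      (∀ (β β'' : ℝ) (m n'' : ℕ), 1 ≤ m → 1 ≤ n'' →
        Real.sqrt m * a β = n'' * a β'' → β = β'' ∧ Real.sqrt m = n'') := by
  obtain ⟨φ, hφ, hinj⟩ := exists_wildExponent_two_sided fun β => -Real.log (g β)
  refine ⟨fun β => Real.exp (-φ β), fun β => Real.exp_pos _, fun β => ?_, fun β => ?_, ?_, ?_⟩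
  · have h1 : -φ β ≤ Real.log (g β) := by have := (hφ β).1; linarith
    calc Real.exp (-φ β) ≤ Real.exp (Real.log (g β)) := Real.exp_le_exp.2 h1
      _ = g β := Real.exp_log (hg β)
  · have h1 : Real.log (g β) - Real.log 2 ≤ -φ β := by have := (hφ β).2; linarith
    have h2 : Real.exp (Real.log (g β) - Real.log 2) ≤ Real.exp (-φ β) := Real.exp_le_exp.2 h1
    rw [Real.exp_sub, Real.exp_log (hg β), Real.exp_log (by norm_num : (0 : ℝ) < 2)] at h2
    linarith [(div_le_iff₀ (by norm_num : (0 : ℝ) < 2)).1 h2]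
  · intro β β' n n' hn hn' heq
    have hnpos : (0 : ℝ) < n := by exact_mod_cast hn
    have hn'pos : (0 : ℝ) < n' := by exact_mod_cast hn'
    have hlog := congrArg Real.log heq
    rw [Real.log_mul hnpos.ne' (Real.exp_pos _).ne', Real.log_mul hn'pos.ne' (Real.exp_pos _).ne',
      Real.log_exp, Real.log_exp] at hlog
    have hdiff : φ β - φ β' = Real.log n - Real.log n' := by linarith
    have hmem : φ β - φ β' ∈ (Submodule.span ℚ (Set.range fun n : ℕ => Real.log (n : ℝ))) := by
      rw [hdiff]
      exact Submodule.sub_mem (Submodule.span ℚ (Set.range fun n : ℕ => Real.log (n : ℝ)))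
        (log_nat_mem_logSpan n) (log_nat_mem_logSpan n')
    have hββ' : β = β' := hinj β β' hmem
    subst hββ'
    refine ⟨rfl, ?_⟩
    have : (n : ℝ) = n' := by
      have hne : Real.exp (-φ β) ≠ 0 := (Real.exp_pos _).ne'
      exact mul_right_cancel₀ hne heq
    exact_mod_cast this
  · intro β β'' m n'' hm hn'' heq
    have hmpos : (0 : ℝ) < m := by exact_mod_cast hm
    have hsq : 0 < Real.sqrt m := Real.sqrt_pos.2 hmpos
    have hn''pos : (0 : ℝ) < n'' := by exact_mod_cast hn''
    have hlog := congrArg Real.log heq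
    rw [Real.log_mul hsq.ne' (Real.exp_pos _).ne', Real.log_mul hn''pos.ne' (Real.exp_pos _).ne',
      Real.log_exp, Real.log_exp, Real.log_sqrt hmpos.le] at hlog
    have hdiff : φ β - φ β'' = Real.log m / 2 - Real.log n'' := by linarith
    have hmem : φ β - φ β'' ∈ (Submodule.span ℚ (Set.range fun n : ℕ => Real.log (n : ℝ))) := by
      rw [hdiff]; exact half_log_sub_log_mem_logSpan m n''
    have hββ'' : β = β'' := hinj β β'' hmem
    subst hββ''
    refine ⟨rfl, ?_⟩
    have hne : Real.exp (-φ β) ≠ 0 := (Real.exp_pos _).ne'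
    exact mul_right_cancel₀ hne heq

/-! ## Package transfer to a dominating wild map -/

section Transfer

variable {G : Type} [Group G] [TopologicalSpace G] [IsTopologicalGroup G] [CompactSpace G]
  [MeasurableSpace G] [BorelSpace G]

omit [TopologicalSpace G] [IsTopologicalGroup G] [CompactSpace G] [MeasurableSpace G] [BorelSpace G] in
/-- The torus distance is at most the side. -/
theorem torusDist_le {L : ℕ} [NeZero L] (x y : Site 4 L) : torusDist L x y ≤ L := by
  unfold torusDist
  have hk : ∀ k : Fin 4, (((x k - y k).valMinAbs : ℤ) : ℝ) ^ 2 ≤ ((L : ℝ) / 2) ^ 2 := by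
    intro k
    have h1 : (((x k - y k).valMinAbs.natAbs : ℕ) : ℝ) ≤ (L : ℝ) / 2 := by
      have h := ZMod.natAbs_valMinAbs_le (x k - y k)
      calc (((x k - y k).valMinAbs.natAbs : ℕ) : ℝ) ≤ ((L / 2 : ℕ) : ℝ) := by exact_mod_cast h
        _ ≤ (L : ℝ) / 2 := Nat.cast_div_le
    have h2 : |(((x k - y k).valMinAbs : ℤ) : ℝ)| = (((x k - y k).valMinAbs.natAbs : ℕ) : ℝ) := by
      rw [← Int.cast_abs, ← Int.natCast_natAbs, Int.cast_natCast]
    have h3 : |(((x k - y k).valMinAbs : ℤ) : ℝ)| ≤ (L : ℝ) / 2 := h2 ▸ h1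
    have h4 : (0 : ℝ) ≤ (L : ℝ) / 2 := by positivity
    calc (((x k - y k).valMinAbs : ℤ) : ℝ) ^ 2 = |(((x k - y k).valMinAbs : ℤ) : ℝ)| ^ 2 := (sq_abs _).symm
      _ ≤ ((L : ℝ) / 2) ^ 2 := pow_le_pow_left₀ (abs_nonneg _) h3 2
  have hsum : ∑ k : Fin 4, (((x k - y k).valMinAbs : ℤ) : ℝ) ^ 2 ≤ (L : ℝ) ^ 2 := by
    calc ∑ k : Fin 4, (((x k - y k).valMinAbs : ℤ) : ℝ) ^ 2 ≤ ∑ _k : Fin 4, ((L : ℝ) / 2) ^ 2 :=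
          Finset.sum_le_sum fun k _ => hk k
      _ = (L : ℝ) ^ 2 := by simp [Finset.sum_const, Finset.card_univ, Fintype.card_fin]; ring
  calc Real.sqrt (∑ k : Fin 4, (((x k - y k).valMinAbs : ℤ) : ℝ) ^ 2) ≤ Real.sqrt ((L : ℝ) ^ 2) :=
        Real.sqrt_le_sqrt hsum
    _ = L := Real.sqrt_sq (Nat.cast_nonneg L)

/-- **Package transfer.**  If `a₀` carries the two-point package and `a` is a positive unit map (`a → 0`) with
SINGLETON level sets that dominates `a₀` up to a constant (`a₀ ≤ M·a`: every femto box of `a` is a femto box of `a₀`),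
then `a` carries the package too: `Γ(n·a β) := Γ₀(n·a₀ β)` on the levels of `a` (well defined), `Γ := 1` elsewhere;
`β₀`, `c`, `C` unchanged, `ℓ₀ ↦ ℓ₀/M`.  No uniformity, no physics — bookkeeping of the typed clauses. -/
theorem twoPointPackage_transfer (r : LatticeRep G) {a₀ a : ℝ → ℝ} (h₀ : TwoPointPackage r a₀)
    (ha : ∀ β, 0 < a β) (ha0 : Tendsto a atTop (𝓝 0)) {M : ℝ} (hM : 1 ≤ M)
    (hdom : ∀ β, a₀ β ≤ M * a β)
    (huniq : ∀ (β β' : ℝ) (n n' : ℕ), 1 ≤ n → 1 ≤ n' → (n : ℝ) * a β = n' * a β' → β = β' ∧ n = n')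
    (hdist : ∀ (β β'' : ℝ) (m n'' : ℕ), 1 ≤ m → 1 ≤ n'' →
      Real.sqrt m * a β = n'' * a β'' → β = β'' ∧ Real.sqrt m = n'') :
    TwoPointPackage r a := by
  classical
  obtain ⟨Γ₀, β₀, ℓ₀, c, C, hℓ₀, hc, ha₀, ha₀0, hΓ₀, hbox⟩ := h₀
  have hM0 : 0 < M := lt_of_lt_of_le one_pos hM
  -- the transferred shape function
  let IsLevel : ℝ → Prop := fun s => ∃ p : ℕ × ℝ, 1 ≤ p.1 ∧ s = (p.1 : ℝ) * a p.2
  let Γ : ℝ → ℝ := fun s =>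
    if hs : IsLevel s then Γ₀ (((Classical.choose hs).1 : ℝ) * a₀ (Classical.choose hs).2) else 1
  have hΓlevel : ∀ (n : ℕ) (β : ℝ), 1 ≤ n → Γ ((n : ℝ) * a β) = Γ₀ ((n : ℝ) * a₀ β) := by
    intro n β hn
    have hs : IsLevel ((n : ℝ) * a β) := ⟨(n, β), hn, rfl⟩
    have hdef : Γ ((n : ℝ) * a β) = Γ₀ (((Classical.choose hs).1 : ℝ) * a₀ (Classical.choose hs).2) := by
      simp only [Γ, dif_pos hs]
    rw [hdef]
    obtain ⟨hn', heq⟩ := Classical.choose_spec hs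
    obtain ⟨hβ, hnn⟩ := huniq β (Classical.choose hs).2 n (Classical.choose hs).1 hn hn' heq
    rw [← hβ]
    have hcast : ((Classical.choose hs).1 : ℝ) = (n : ℝ) := by exact_mod_cast hnn.symm
    rw [hcast]
  have hΓoff : ∀ s : ℝ, ¬ IsLevel s → Γ s = 1 := fun s hs => by simp only [Γ, dif_neg hs]
  -- admissible data for `a` are admissible for `a₀`
  have hboxes : ∀ (L : ℕ) (β : ℝ), (L : ℝ) * a β ≤ ℓ₀ / M → (L : ℝ) * a₀ β ≤ ℓ₀ := by
    intro L β hL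
    calc (L : ℝ) * a₀ β ≤ (L : ℝ) * (M * a β) := mul_le_mul_of_nonneg_left (hdom β) (Nat.cast_nonneg L)
      _ = M * ((L : ℝ) * a β) := by ring
      _ ≤ M * (ℓ₀ / M) := mul_le_mul_of_nonneg_left hL hM0.le
      _ = ℓ₀ := mul_div_cancel₀ _ hM0.ne'
  refine ⟨Γ, β₀, ℓ₀ / M, c, C, div_pos hℓ₀ hM0, hc, ha, ha0, ?_, ?_⟩
  · -- `Γ ∈ (0, 1]` on `(0, ℓ₀/M]`
    intro s hs hsℓ
    by_cases hl : IsLevel s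
    · obtain ⟨p, hp1, rfl⟩ := hl
      rw [hΓlevel p.1 p.2 hp1]
      have hp1' : (1 : ℝ) ≤ p.1 := by exact_mod_cast hp1
      refine hΓ₀ _ (mul_pos (by linarith) (ha₀ p.2)) ?_
      calc (p.1 : ℝ) * a₀ p.2 ≤ (p.1 : ℝ) * (M * a p.2) := mul_le_mul_of_nonneg_left (hdom p.2) (by linarith)
        _ = M * ((p.1 : ℝ) * a p.2) := by ring
        _ ≤ M * (ℓ₀ / M) := mul_le_mul_of_nonneg_left hsℓ hM0.le
        _ = ℓ₀ := mul_div_cancel₀ _ hM0.ne'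
    · rw [hΓoff s hl]; exact ⟨one_pos, le_rfl⟩
  · intro L _ β hβ hL
    obtain ⟨hax, hall⟩ := hbox L β hβ (hboxes L β hL)
    refine ⟨fun n hn h8 => ?_, fun x y i j i' j' hxy hij hij' => ?_⟩
    · rw [hΓlevel n β hn]; exact hax n hn h8
    · have hpair := hall x y i j i' j' hxy hij hij'
      obtain ⟨m, hm1, hdm⟩ := torusDist_eq_sqrt_nat x y hxy
      by_cases hl : IsLevel (torusDist L x y * a β)
      · obtain ⟨p, hp1, heq⟩ := hl
        rw [hdm] at heq
        obtain ⟨hββ, hsq⟩ := hdist β p.2 m p.1 hm1 hp1 heq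
        have hd : torusDist L x y = (p.1 : ℝ) := by rw [hdm, hsq]
        rw [hd, hΓlevel p.1 β hp1]
        rw [hd] at hpair
        exact hpair
      · rw [hΓoff _ hl, mul_one]
        -- `Γ₀ (d·a₀ β) ∈ (0, 1]` since `0 < d ≤ L` and `L·a₀ β ≤ ℓ₀`
        have hdpos : 0 < torusDist L x y := by
          rw [hdm]; exact Real.sqrt_pos.2 (by exact_mod_cast hm1)
        have hdℓ : torusDist L x y * a₀ β ≤ ℓ₀ :=
          le_trans (mul_le_mul_of_nonneg_right (torusDist_le x y) (ha₀ β).le) (hboxes L β hL)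
        obtain ⟨hΓpos, hΓle⟩ := hΓ₀ _ (mul_pos hdpos (ha₀ β)) hdℓ
        have hnonneg : 0 ≤ |wCov r L β (plaq r L x i j) (plaq r L y i' j')| * torusDist L x y ^ 8 := by
          positivity
        have hC : 0 ≤ C := le_of_mul_le_mul_right (by linarith) hΓpos
        exact hpair.trans (by nlinarith)

/-- **From one package map, an incomparable one.**  If `a₀` carries the package then so does a wild map `a` squeezed
between `g/2` and `g`, `g := √a₀ + a₀` (so `a₀ ≤ 2a`, boxes contained; `a₀/a ≤ 2√a₀ → 0`, incomparable). -/
theorem exists_incomparable_package_of_package (r : LatticeRep G) {a₀ : ℝ → ℝ} (h₀ : TwoPointPackage r a₀) :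
    ∃ a : ℝ → ℝ, TwoPointPackage r a ∧ ∀ ε : ℝ, 0 < ε → ∀ β₂ : ℝ, ∃ β : ℝ, β₂ ≤ β ∧ a₀ β < ε * a β := by
  obtain ⟨Γ₀, β₀, ℓ₀, c, C, -, -, ha₀, ha₀0, -⟩ := id h₀
  have hgpos : ∀ β, 0 < Real.sqrt (a₀ β) + a₀ β := fun β =>
    add_pos_of_nonneg_of_pos (Real.sqrt_nonneg _) (ha₀ β)
  have hsqrt0 : Tendsto (fun β => Real.sqrt (a₀ β)) atTop (𝓝 0) := by
    have := (Real.continuous_sqrt.tendsto 0).comp ha₀0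
    rwa [Real.sqrt_zero] at this
  have hg0 : Tendsto (fun β => Real.sqrt (a₀ β) + a₀ β) atTop (𝓝 0) := by
    simpa using hsqrt0.add ha₀0
  obtain ⟨a, ha, hag, hga, huniq, hdist⟩ := exists_wildMap_two_sided (fun β => Real.sqrt (a₀ β) + a₀ β) hgpos
  have ha0 : Tendsto a atTop (𝓝 0) :=
    tendsto_of_tendsto_of_tendsto_of_le_of_le tendsto_const_nhds hg0 (fun β => (ha β).le) hag
  have hdom : ∀ β, a₀ β ≤ 2 * a β := fun β =>
    le_trans (le_add_of_nonneg_left (Real.sqrt_nonneg _)) (hga β)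
  refine ⟨a, twoPointPackage_transfer r h₀ ha ha0 (M := 2) (by norm_num) hdom huniq hdist, fun ε hε β₂ => ?_⟩
  have hev : ∀ᶠ β in atTop, a₀ β ∈ Set.Iio ((ε / 2) ^ 2) :=
    ha₀0.eventually_mem (Iio_mem_nhds (by positivity))
  obtain ⟨β, hβ₂, hβ⟩ := ((eventually_ge_atTop β₂).and hev).exists
  refine ⟨β, hβ₂, ?_⟩
  have hlt : a₀ β < (ε / 2) ^ 2 := hβ
  have hs : Real.sqrt (a₀ β) < ε / 2 := by
    rw [Real.sqrt_lt' (by positivity)]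
    exact hlt
  calc a₀ β = Real.sqrt (a₀ β) * Real.sqrt (a₀ β) := (Real.mul_self_sqrt (ha₀ β).le).symm
    _ < ε / 2 * Real.sqrt (a₀ β) := mul_lt_mul_of_pos_right hs (Real.sqrt_pos.2 (ha₀ β))
    _ ≤ ε / 2 * (Real.sqrt (a₀ β) + a₀ β) :=
        mul_le_mul_of_nonneg_left (le_add_of_nonneg_right (ha₀ β).le) (by positivity)
    _ ≤ ε / 2 * (2 * a β) := mul_le_mul_of_nonneg_left (hga β) (by positivity)
    _ = ε * a β := by ring

end Transfer

/-! ## The residual stub and its characterisation -/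

/-- **Verbatim copy of line `Sketch-ideator3`'s residual stub** `PackagePinsScale` (skeleton
`Cruxes/FemtoCurvatureSkewness/Lines/Sketch_ideator3.lean`): two unit maps carrying the two-point package of
`FemtoCurvatureTwoPoint` (same `G`, `r`) are comparable, `ε·a ≤ a'` for all large `β`. -/
def PackagePinsScale : Prop :=
  ∀ (G : Type) [Group G] [TopologicalSpace G] [IsTopologicalGroup G] [CompactSpace G],
    IsCompactSimpleLieGroup G →
      letI : MeasurableSpace G := borel G
      haveI : BorelSpace G := ⟨rfl⟩
      ∀ (r : LatticeRep G) (a a' : ℝ → ℝ), TwoPointPackage r a → TwoPointPackage r a' →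
        ∃ ε β₂ : ℝ, 0 < ε ∧ ∀ β : ℝ, β₂ ≤ β → ε * a β ≤ a' β

/-- **The residual stub says exactly that the crux's hypothesis is never met.**  `PackagePinsScale` holds iff NO
unit map carries the two-point package, for every compact simple `G` and every `r` — because any package map `a₀`
has an incomparable package companion (`exists_incomparable_package_of_package`).  So the stub (hence the line's
composition for the TYPED crux) lives only in the world where `FemtoCurvatureTwoPoint` fails for every `(G, r)` and the
crux is vacuous. -/
theorem packagePinsScale_iff_package_unsatisfiable : PackagePinsScale ↔
    ∀ (G : Type) [Group G] [TopologicalSpace G] [IsTopologicalGroup G] [CompactSpace G],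
      IsCompactSimpleLieGroup G →
        letI : MeasurableSpace G := borel G
        haveI : BorelSpace G := ⟨rfl⟩
        ∀ (r : LatticeRep G) (a : ℝ → ℝ), ¬ TwoPointPackage r a := by
  constructor
  · intro hP G _ _ _ _ hG
    letI : MeasurableSpace G := borel G
    haveI : BorelSpace G := ⟨rfl⟩
    intro r a₀ h₀
    obtain ⟨a, ha, hinc⟩ := exists_incomparable_package_of_package r h₀
    obtain ⟨ε, β₂, hε, hle⟩ := hP G hG r a a₀ ha h₀
    obtain ⟨β, hβ₂, hlt⟩ := hinc ε hε β₂
    exact absurd (hle β hβ₂) (not_le.2 hlt)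
  · intro hno G _ _ _ _ hG
    letI : MeasurableSpace G := borel G
    haveI : BorelSpace G := ⟨rfl⟩
    intro r a a' ha _
    exact absurd ha (hno G hG r a)

/-- **The stub is false in every world with one instance of the route's rank-2 crux**: given the classical simplicity
of `SU(n)` (tree statement `isSimpleCompactGroup_specialUnitaryGroup`) and `FemtoCurvatureTwoPoint` (crux 9363),
`SU(2)` with any of its faithful unitary representations carries a package map, so `PackagePinsScale` fails. -/
theorem packagePinsScale_false_of_twoPoint
    (hSU : Literature.MathematicalPhysics.QuantumLattice.isSimpleCompactGroup_specialUnitaryGroup.{0})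
    (hTP : FemtoCurvatureTwoPoint) : ¬ PackagePinsScale := by
  intro hP
  have hG : IsCompactSimpleLieGroup (Matrix.specialUnitaryGroup (Fin 2) ℂ) :=
    isCompactSimpleLieGroup_specialUnitaryGroup hSU le_rfl
  letI : MeasurableSpace (Matrix.specialUnitaryGroup (Fin 2) ℂ) := borel _
  haveI : BorelSpace (Matrix.specialUnitaryGroup (Fin 2) ℂ) := ⟨rfl⟩
  obtain ⟨r⟩ := hG.2
  obtain ⟨a, ha⟩ := hTP (Matrix.specialUnitaryGroup (Fin 2) ℂ) hG r
  exact packagePinsScale_iff_package_unsatisfiable.1 hP _ hG r a ha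


/-! ## §1, §2, §2b, §2c — LANDED
All of: vocabulary `plaq`/`wE`/`wCov`/`kappa3`/`torusDist`/`TwoPointPackage`/`SkewnessPackage` and `femtoCurvatureSkewness_iff`
(the crux unbundled, `Iff.rfl`); `kappa3_zero_coupling`, `not_skewnessBoundAllCouplings`; `skewnessPackage_iff_levelwise`,
`eventually_kappa3_ne_zero`, `zero_of_sign_change`; `tendsto_kappa3`, `skewnessShape_tendsto_zero`,
`not_skewnessPackageWith_of_shape_ge`, `not_uniformSkewness`; `wE_eq_inv_mul_integral`, `continuous_wE`, `continuous_kappa3`,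
`exists_zero_of_sign_change`, `twoPointPackage_forces_cov_pos` now live in
`Theorems/FemtoCurvatureSkewness/Negative/{ZeroCoupling,WeakCoupling}.lean` (p74674, p75362) and are imported here. -/

/-! ## §3 Crux-level structure (kept in the work file: theorem types mention the Theses decl) -/

section Structure

variable {G : Type} [Group G] [TopologicalSpace G] [IsTopologicalGroup G] [CompactSpace G]
  [MeasurableSpace G] [BorelSpace G]

/-- **What the crux forces, for every admissible unit map**: fixed-torus eventual non-vanishing of `κ₃`. -/
theorem crux_forces_eventual_nonvanishing (hcrux : FemtoCurvatureSkewness) (G : Type) [Group G]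
    [TopologicalSpace G] [IsTopologicalGroup G] [CompactSpace G] (hG : IsCompactSimpleLieGroup G) :
    letI : MeasurableSpace G := borel G
    haveI : BorelSpace G := ⟨rfl⟩
    ∀ (r : LatticeRep G) (a : ℝ → ℝ), TwoPointPackage r a →
      ∀ (L : ℕ) [NeZero L] (n : ℕ), 1 ≤ n → 8 * n ≤ L → ∀ᶠ β in atTop, kappa3 r L β n ≠ 0 := by
  letI : MeasurableSpace G := borel G
  haveI : BorelSpace G := ⟨rfl⟩
  intro r a hTP L _ n hn h8
  obtain ⟨Γ, β₀, ℓ₀, c, C, -, -, ha, ha0, -⟩ := id hTP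
  exact eventually_kappa3_ne_zero r ha ha0 (femtoCurvatureSkewness_iff.1 hcrux G hG r a hTP) L n hn h8

/-- **Kill criterion I (admissible zeros).**  A two-point witness `(G, r, a)` together with an exact zero of
`κ₃` inside EVERY window `{β ≥ β₁, L a(β) ≤ ℓ₁, 1 ≤ n ≤ L/8}` refutes the crux. -/
theorem not_crux_of_admissible_zero
    (h : ∃ (G : Type) (_ : Group G) (_ : TopologicalSpace G) (_ : IsTopologicalGroup G)
      (_ : CompactSpace G) (_ : IsCompactSimpleLieGroup G),
      letI : MeasurableSpace G := borel G
      haveI : BorelSpace G := ⟨rfl⟩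
      ∃ (r : LatticeRep G) (a : ℝ → ℝ), TwoPointPackage r a ∧
        ∀ β₁ ℓ₁ : ℝ, 0 < ℓ₁ → ∃ (L : ℕ) (_ : NeZero L) (β : ℝ) (n : ℕ),
          β₁ ≤ β ∧ (L : ℝ) * a β ≤ ℓ₁ ∧ 1 ≤ n ∧ 8 * n ≤ L ∧ kappa3 r L β n = 0) :
    ¬ FemtoCurvatureSkewness := by
  intro hcrux
  obtain ⟨G, _, _, _, _, hG, r, a, hTP, hzero⟩ := h
  obtain ⟨Γ, β₀, ℓ₀, c, C, -, -, ha, -, -⟩ := id hTP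
  obtain ⟨Γ₃, β₁, ℓ₁, c₃, hℓ₁, hc₃, hΓ₃, hb⟩ := femtoCurvatureSkewness_iff.1 hcrux G hG r a hTP
  obtain ⟨L, _, β, n, hβ, hL, hn, h8, h0⟩ := hzero β₁ ℓ₁ hℓ₁
  obtain ⟨hs, hsℓ⟩ := level_mem_window ha hL hn h8
  have key := hb L β hβ hL n hn h8
  rw [h0, abs_zero, mul_zero] at key
  exact absurd key (not_le.2 (mul_pos hc₃ (hΓ₃ _ hs hsℓ)))

/-- **Kill criterion II (one torus, zeros at arbitrarily large coupling).**  A two-point witness together with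
ONE torus `L ≥ 8n` on which `β ↦ κ₃(L,β,n)` vanishes frequently as `β → ∞` refutes the crux. -/
theorem not_crux_of_frequently_zero
    (h : ∃ (G : Type) (_ : Group G) (_ : TopologicalSpace G) (_ : IsTopologicalGroup G)
      (_ : CompactSpace G) (_ : IsCompactSimpleLieGroup G),
      letI : MeasurableSpace G := borel G
      haveI : BorelSpace G := ⟨rfl⟩
      ∃ (r : LatticeRep G) (a : ℝ → ℝ), TwoPointPackage r a ∧
        ∃ (L : ℕ) (_ : NeZero L) (n : ℕ), 1 ≤ n ∧ 8 * n ≤ L ∧ ∃ᶠ β in atTop, kappa3 r L β n = 0) :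
    ¬ FemtoCurvatureSkewness := by
  intro hcrux
  obtain ⟨G, _, _, _, _, hG, r, a, hTP, L, _, n, hn, h8, hfreq⟩ := h
  exact hfreq (crux_forces_eventual_nonvanishing hcrux G hG r a hTP L n hn h8)

/-- **Why the crux resists** (the shield): any refutation of `FemtoCurvatureSkewness` produces a witness of the
two-point package, i.e. an instance of the (open) sibling crux `FemtoCurvatureTwoPoint` for some `(G, r)`. -/
theorem refutation_needs_twoPoint_witness (h : ¬ FemtoCurvatureSkewness) :
    ∃ (G : Type) (_ : Group G) (_ : TopologicalSpace G) (_ : IsTopologicalGroup G)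
      (_ : CompactSpace G) (_ : IsCompactSimpleLieGroup G),
      letI : MeasurableSpace G := borel G
      haveI : BorelSpace G := ⟨rfl⟩
      ∃ (r : LatticeRep G) (a : ℝ → ℝ), TwoPointPackage r a ∧ ¬ SkewnessPackage r a := by
  by_contra hno
  apply h
  rw [femtoCurvatureSkewness_iff]
  intro G _ _ _ _ hG r a hTP
  by_contra hS
  exact hno ⟨G, _, _, _, _, hG, r, a, hTP, hS⟩

end Structure

/-! ## §5 Line `Sketch-ideator3` (picked 2026-08-16; lead prover-line-stmt-QuantumFields-9365-0)

Stubs: `PermanentalRigidity`, `PerpPropagatorPos`, `HypercubicCovSymmetry`, `DominanceFromCoupling`, `TotalCumulance` —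
LANDED by the lead (proved; nothing to refute).  Open: the ENGINE `PermanentalCouplingFromInputs` (conditional on a
package map; not attackable without a 9363 witness — same shield as the crux) and the RESIDUAL `PackagePinsScale`
(`disprover-wanted`).  Verdict on the residual — STUB-FALSE modulo any package instance, LANDED p94300
`Theorems/FemtoCurvatureSkewness/Negative/PackagePinsScale.lean`:
`packagePinsScale_iff_package_unsatisfiable : PackagePinsScale ↔ ∀ G simple r a, ¬ TwoPointPackage r a`
(two-sided wild map `g/2 ≤ a ≤ g`, `g = √a₀ + a₀`, + verbatim transfer of `a₀`'s own package — NO uniformities),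
`packagePinsScale_false_of_twoPoint : isSimpleCompactGroup_SU(n) → FemtoCurvatureTwoPoint → ¬ PackagePinsScale`.
Hence (below) the stub implies the crux VACUOUSLY: in the line's composition `FemtoCurvatureSkewness_of hE hP` the engine
`hE` is idle.  JOINT SUFFICIENCY is kernel-checked in the skeleton (nothing to attack); the defect is that `hP` is the
negation of the crux being non-vacuous.  No engine-free repair of the residual exists (every package map has incomparable
package companions); only a RESTATEMENT of the crux (planners' R1, the ∃-bundled `SkewnessForPackageMap` that `closes`
consumes; the skeleton's `skewnessForPackageMap_of hE` then closes modulo the engine alone) discharges the `∀ a` shell.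
Numerical check of the ENGINE's typed output `CouplingBounds` (relative accuracy 1/8 of the permanental prediction
`|κ₃| ≈ √(8/d)·(Cov₀₂Cov₀₃Cov₂₃)^{1/2}`) at the admissible configuration (L=8, n=1), SU(2) fundamental, from MCSignScan-c1:
`κ₃/κ₃^perm = 0.62, 0.80, 0.89, 0.86, 0.93, 0.86 (±0.05–0.06)` at `β_tree = 1.1, 1.2, 1.35, 1.5, 2.0, 3.0` — the 1/8
accuracy holds (within errors) for `β_tree ≥ 1.35` (β_std ≥ 2.7) and fails in the crossover: consistent with `β ≥ β₁`,
`β₁(L=8) ≈ 1.3`; supportive, not a refutation. -/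

/-- **The residual stub closes the typed crux on its own — vacuously.**  (`PackagePinsScale` says no unit map ever
carries the two-point package, `packagePinsScale_iff_package_unsatisfiable`; then the crux's hypothesis is never met.) -/
theorem femtoCurvatureSkewness_of_packagePinsScale (hP : PackagePinsScale) : FemtoCurvatureSkewness := by
  rw [femtoCurvatureSkewness_iff]
  intro G _ _ _ _ hG
  letI : MeasurableSpace G := borel G
  haveI : BorelSpace G := ⟨rfl⟩
  intro r a ha
  exact absurd ha (packagePinsScale_iff_package_unsatisfiable.1 hP G hG r a)

/-- **For the typed crux, the line is exactly as strong as the vacuity of the crux's hypothesis**: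
`PackagePinsScale` (the residual every line on this crux carries, triage r1-2 note X) is refuted by any single instance of
`FemtoCurvatureTwoPoint` at a compact simple group — here `SU(2)` given the classical simplicity fact. -/
theorem line_residual_false_of_twoPoint
    (hSU : Literature.MathematicalPhysics.QuantumLattice.isSimpleCompactGroup_specialUnitaryGroup.{0})
    (hTP : FemtoCurvatureTwoPoint) : ¬ PackagePinsScale :=
  packagePinsScale_false_of_twoPoint hSU hTP

section Companion

variable {G : Type} [Group G] [TopologicalSpace G] [IsTopologicalGroup G] [CompactSpace G]
  [MeasurableSpace G] [BorelSpace G]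

/-- **Slower companions are harmless for the crux** (the direction of the `∀ a` exposure).  The skewness package
transfers, exactly like the two-point package (`twoPointPackage_transfer`), from `a₀` to every positive map `a` with
singleton axis levels that DOMINATES `a₀` (`a₀ ≤ M·a`: smaller femto boxes): `Γ₃(n·a β) := Γ₃⁰(n·a₀ β)` on the levels,
`1` elsewhere, `ℓ₁ ↦ ℓ₁/M`.  So the incomparable companions that kill `PackagePinsScale`
(`exists_incomparable_package_of_package`: slower maps) satisfy the crux's conclusion whenever `a₀` does; the crux is
exposed only to FASTER package maps (bigger boxes — the lead's `WildPackage`, modulo infrared uniformities), where the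
conclusion becomes global non-vanishing of `κ₃` (finding 3). -/
theorem skewnessPackage_transfer (r : LatticeRep G) {a₀ a : ℝ → ℝ} (h₀ : SkewnessPackage r a₀)
    (ha₀ : ∀ β, 0 < a₀ β) {M : ℝ} (hM : 1 ≤ M) (hdom : ∀ β, a₀ β ≤ M * a β)
    (huniq : ∀ (β β' : ℝ) (n n' : ℕ), 1 ≤ n → 1 ≤ n' → (n : ℝ) * a β = n' * a β' → β = β' ∧ n = n') :
    SkewnessPackage r a := by
  classical
  obtain ⟨Γ₃, β₁, ℓ₁, c₃, hℓ₁, hc₃, hΓ₃, hb⟩ := h₀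
  have hM0 : 0 < M := lt_of_lt_of_le one_pos hM
  let IsLevel : ℝ → Prop := fun s => ∃ p : ℕ × ℝ, 1 ≤ p.1 ∧ s = (p.1 : ℝ) * a p.2
  let Γ : ℝ → ℝ := fun s =>
    if hs : IsLevel s then Γ₃ (((Classical.choose hs).1 : ℝ) * a₀ (Classical.choose hs).2) else 1
  have hΓlevel : ∀ (n : ℕ) (β : ℝ), 1 ≤ n → Γ ((n : ℝ) * a β) = Γ₃ ((n : ℝ) * a₀ β) := by
    intro n β hn
    have hs : IsLevel ((n : ℝ) * a β) := ⟨(n, β), hn, rfl⟩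
    have hdef : Γ ((n : ℝ) * a β) = Γ₃ (((Classical.choose hs).1 : ℝ) * a₀ (Classical.choose hs).2) := by
      simp only [Γ, dif_pos hs]
    rw [hdef]
    obtain ⟨hn', heq⟩ := Classical.choose_spec hs
    obtain ⟨hβ, hnn⟩ := huniq β (Classical.choose hs).2 n (Classical.choose hs).1 hn hn' heq
    rw [← hβ]
    have hcast : ((Classical.choose hs).1 : ℝ) = (n : ℝ) := by exact_mod_cast hnn.symm
    rw [hcast]
  have hΓoff : ∀ s : ℝ, ¬ IsLevel s → Γ s = 1 := fun s hs => by simp only [Γ, dif_neg hs]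
  have hboxes : ∀ (L : ℕ) (β : ℝ), (L : ℝ) * a β ≤ ℓ₁ / M → (L : ℝ) * a₀ β ≤ ℓ₁ := by
    intro L β hL
    calc (L : ℝ) * a₀ β ≤ (L : ℝ) * (M * a β) := mul_le_mul_of_nonneg_left (hdom β) (Nat.cast_nonneg L)
      _ = M * ((L : ℝ) * a β) := by ring
      _ ≤ M * (ℓ₁ / M) := mul_le_mul_of_nonneg_left hL hM0.le
      _ = ℓ₁ := mul_div_cancel₀ _ hM0.ne'
  refine ⟨Γ, β₁, ℓ₁ / M, c₃, div_pos hℓ₁ hM0, hc₃, ?_, ?_⟩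
  · intro s hs hsℓ
    by_cases hl : IsLevel s
    · obtain ⟨p, hp1, rfl⟩ := hl
      rw [hΓlevel p.1 p.2 hp1]
      have hp1' : (1 : ℝ) ≤ p.1 := by exact_mod_cast hp1
      refine hΓ₃ _ (mul_pos (by linarith) (ha₀ p.2)) ?_
      calc (p.1 : ℝ) * a₀ p.2 ≤ (p.1 : ℝ) * (M * a p.2) := mul_le_mul_of_nonneg_left (hdom p.2) (by linarith)
        _ = M * ((p.1 : ℝ) * a p.2) := by ring
        _ ≤ M * (ℓ₁ / M) := mul_le_mul_of_nonneg_left hsℓ hM0.le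
        _ = ℓ₁ := mul_div_cancel₀ _ hM0.ne'
    · rw [hΓoff s hl]; exact one_pos
  · intro L _ β hβ hL n hn h8
    rw [hΓlevel n β hn]
    exact hb L β hβ (hboxes L β hL) n hn h8

end Companion

/-! ## §4 Near-misses and targets

* TARGETS (cycle 2): line `Sketch-ideator3` — residual `PackagePinsScale`: KILLED modulo any package instance (§5,
  p94300); engine `PermanentalCouplingFromInputs`: shielded (needs a 9363 witness), numerically plausible at (8, n=1) for
  `β_tree ≥ 1.35` (SU(2)).
* NEAR-MISS A (blocked): `∃ a, TwoPointPackage r a` for `G = SU(2)`, `r` fundamental — this IS crux 9363 for SU(2);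
  without it no `¬ FemtoCurvatureSkewness` can be landed (`refutation_needs_twoPoint_witness`).
* NEAR-MISS B (paper-certain for `E[T_r³] > 0`, numerics: below MC resolution): an exact zero `κ₃(L, β*, n) = 0`, `β* > 0`,
  on every torus for (G, r) with `r ⊗ r ∋ r` or `r̄` (SU(3) fundamental; SU(2), `r = ½ ⊕ 1`), from the sign change
  strong (−) → weak (+) coupling (finding 3) and `continuous_kappa3`; MC j010028 sees the `+` side (14–31σ) and cannot
  resolve the predicted `−10⁻⁵` strong side (MCSignScan-c1.md).  It does not refute the crux (β₁ is existential); it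
  becomes a kill only for unit maps whose windows reach such zeros at ARBITRARILY LARGE β, i.e. iff the IR sign at weak
  bare coupling is `−`.  Not Lean-provable here: the `β⁸` coefficient is an explicit but 11-character Haar integral and an
  8-fold derivative under the integral sign.
* SU(2) fundamental (MC j008044/j008055): `κ₃(L,β,1) > 0` at 7–34σ for `β_tree ∈ [0.9, 3]`, `L = 6, 8`; no sign change
  resolved anywhere; scale-free ratio `κ₃/Cov^{3/2} ≈ 0.40–0.51`, β-stable — the adversarial-unit-map attack has no
  target in this channel.
-/

end Summit.QuantumFields.YangMills.Cruxes.FemtoCurvatureSkewness.Disproof
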